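import Mathlib
import Literature.Analysis.FluidPDE.VectorCalculus
import Literature.Analysis.FluidPDE.HessianLaplacian
import Summits.NavierStokesRegularity.NavierStokesRegularity.Theorems.ThreadingFluxErtelTowerLaplacianTools
import Summits.NavierStokesRegularity.NavierStokesRegularity.Theorems.ThreadingFluxErtelTowerStrainShadowFrame
import HarnessLib

/-!
# Crux `PoloidalLiouville` (stmt-NavierStokesRegularity-1222, W1), crux idea «radial-jerk-tower» (ns-idea-15 g7):
# THE STRAIN SHADOW, III — the scalar equation for the coefficient `k`

Support file (`--supports stmt-NavierStokesRegularity-1222`, helper).  Experiment cell `ns-wall-extremal`, width hand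
ns-wall-eng-5 g6, director KEY-NS #186 («V21 radial-jerk-tower sizes go to eng-5 g6»); critic of record ns-wall-crit-1 g4
(V21 PASS-WITH-PRICE; V21-P2 types `StrainShadowClassificationLocal` as the M rung).  0 kit.

For `B = k·B⋆` on an open `I × U` off the principal planes solving the passive viscous equation, with radial space gradient
`∇k = λx`: component `0` of the equation, the survivor's own steady equation (`survivor_pde_apply_zero`), the local Leibniz
rule for `Δ(k B⋆₀)` and the Euler identity `DB⋆₀[x] = (xᵀSx/ν + 2)B⋆₀` give

* ★ `shadow_coeff_pde` — `∂ₜk − ν Dλ[x] − 7νλ = λ·xᵀSx` on `I × U`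

(with the small tools `laplacian_apply_coord`, `laplacian_mul_of_contDiffOn`, `divergence_id_three`, `clm_apply_eq_sum_coord`,
`survivor_apply_zero`, `fderiv_survivor_zero_self`).  This is the sketch's «τ-component ODE `hₜ − (xᵀSx)h₁ − 7νh₁ − ν‖x‖²h₁₁ = 0`»
written for `∇k = λx` (`λ = 2h₁`).

BOOKING (critic's words, V21-P1/P2/P4): a statement about the LINEAR STRAIN SHADOW of the wall — the passive viscous
equation in the prescribed unbounded drift `Sx` — not about `PoloidalLiouville` ⟨1222⟩ or `UnthreadedRigidity` ⟨27585⟩; helper,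
no rung credit on W1 (movement 0); it refutes nothing.  `PoloidalLiouville` (1222) / (27585) OPEN; NS regularity NOT proved.
-/

-- the summit and its single problem share the name (D-0017 nested layout)
set_option linter.dupNamespace false

noncomputable section

namespace Summit.NavierStokesRegularity.NavierStokesRegularity.Theorems.PoloidalLiouville.ErtelTower

open Set Function Filter Topology Metric
open scoped Topology RealInnerProductSpace InnerProductSpace
open Literature.Analysis.FluidPDE
open Summit.NavierStokesRegularity.NavierStokesRegularity.Theorems.PoloidalLiouville.HorizonTower (E3)

/-! ### The strain shadow: the scalar equation for the coefficient `k` -/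

section ShadowCoeff

variable {ν a b c : ℝ} {B : ℝ → E3 → E3} {k lam : ℝ → E3 → ℝ} {I : Set ℝ} {U : Set E3}

/-- Components commute with the Laplacian: `(ΔF)(x) i = Δ(y ↦ F y i)(x)` for `F` of class `C²` at `x`. -/
theorem laplacian_apply_coord {F : E3 → E3} {x : E3} (hF : ContDiffAt ℝ 2 F x) (i : Fin 3) :
    (Laplacian.laplacian F x) i = Laplacian.laplacian (fun y => F y i) x := by
  have h := hF.laplacian_CLM_comp_left (l := (EuclideanSpace.proj i : E3 →L[ℝ] ℝ))
  rw [show (fun y => F y i) = ((EuclideanSpace.proj i : E3 →L[ℝ] ℝ) ∘ F) from rfl, h]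
  rfl

/-- **Leibniz rule for `Δ(fg)` locally**: `f` smooth on an open `U ∋ x`, `g` globally `C²`. -/
theorem laplacian_mul_of_contDiffOn {f g : E3 → ℝ} {x : E3} (hU : IsOpen U) (hf : ContDiffOn ℝ (⊤ : ℕ∞) f U)
    (hg : ContDiff ℝ 2 g) (hx : x ∈ U) :
    Laplacian.laplacian (fun y => f y * g y) x
      = f x * Laplacian.laplacian g x + g x * Laplacian.laplacian f x
        + 2 * ∑ i : Fin 3, fderiv ℝ f x (EuclideanSpace.single i 1) * fderiv ℝ g x (EuclideanSpace.single i 1) := by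
  obtain ⟨f', hf', hff⟩ := exists_contDiff_eventuallyEq hU hf hx
  have hfg : (fun y => f y * g y) =ᶠ[𝓝 x] fun y => f' y * g y := by
    filter_upwards [hff] with y hy; rw [hy]
  rw [(InnerProductSpace.laplacian_congr_nhds hfg).eq_of_nhds, (InnerProductSpace.laplacian_congr_nhds hff).eq_of_nhds,
    hff.eq_of_nhds, hff.fderiv_eq, laplacian_mul_eq (EuclideanSpace.basisFun (Fin 3) ℝ) (hf'.of_le (by norm_cast)) hg x]
  simp only [EuclideanSpace.basisFun_apply]

/-- `div (y ↦ y) = 3` on `ℝ³`. -/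
theorem divergence_id_three (x : E3) : Literature.Analysis.FluidPDE.VectorCalculus.divergence (fun y : E3 => y) x = 3 := by
  rw [divergence_eq_sum_inner_fderiv (EuclideanSpace.basisFun (Fin 3) ℝ)]
  have h : fderiv ℝ (fun y : E3 => y) x = ContinuousLinearMap.id ℝ E3 := fderiv_id
  simp only [h, ContinuousLinearMap.id_apply, EuclideanSpace.basisFun_apply, EuclideanSpace.inner_single_left,
    PiLp.single_apply, Fin.sum_univ_three]
  norm_num

/-- A linear functional on `ℝ³` evaluated at `v` is `Σⱼ vⱼ ℓ(eⱼ)`. -/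
theorem clm_apply_eq_sum_coord (ℓ : E3 →L[ℝ] ℝ) (v : E3) :
    ℓ v = ∑ j : Fin 3, v j * ℓ (EuclideanSpace.single j 1) := by
  conv_lhs => rw [← (EuclideanSpace.basisFun (Fin 3) ℝ).sum_repr v]
  rw [map_sum]
  refine Finset.sum_congr rfl fun j _ => ?_
  rw [map_smul, smul_eq_mul, EuclideanSpace.basisFun_repr, EuclideanSpace.basisFun_apply]

/-- The survivor's first component: `B⋆₀(y) = exp(q/2ν)·(b − c) y₁ y₂`. -/
theorem survivor_apply_zero (y : E3) :
    (Real.exp (quadForm a b c y / (2 * ν)) • topField a b c y) 0 = Real.exp (quadForm a b c y / (2 * ν)) * ((b - c) * y 1 * y 2) := by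
  rw [survivor_apply, (topField_apply a b c y).1]

/-- Euler identity for the survivor's first component: `DB⋆₀(x)[x] = (q/ν + 2)·B⋆₀(x)`. -/
theorem fderiv_survivor_zero_self (hν : ν ≠ 0) (x : E3) :
    ν * fderiv ℝ (fun y : E3 => (Real.exp (quadForm a b c y / (2 * ν)) • topField a b c y) 0) x x
      = (quadForm a b c x + 2 * ν) * (Real.exp (quadForm a b c x / (2 * ν)) * ((b - c) * x 1 * x 2)) := by
  have h : (fun y : E3 => (Real.exp (quadForm a b c y / (2 * ν)) • topField a b c y) 0)
      = fun y : E3 => Real.exp (quadForm a b c y / (2 * ν)) * ((b - c) * y 1 * y 2) := funext fun y => survivor_apply_zero y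
  rw [h]
  have hE : DifferentiableAt ℝ (fun y : E3 => Real.exp (quadForm a b c y / (2 * ν))) x :=
    (contDiff_sigma ν a b c (n := 1)).differentiable (by simp) x
  have hm : DifferentiableAt ℝ (fun y : E3 => (b - c) * y 1 * y 2) x :=
    (contDiff_topField_apply a b c 0 (n := 1)).differentiable (by simp) x |>.congr_of_eventuallyEq
      (Filter.Eventually.of_forall fun y => ((topField_apply a b c y).1).symm)
  rw [fderiv_fun_mul hE hm]
  simp only [_root_.add_apply, _root_.FunLike.coe_smul, Pi.smul_apply, smul_eq_mul]
  rw [fderiv_sigma_apply ν a b c hν, fderiv_monomial_apply, strain_dot_self]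
  field_simp
  ring

/-- **THE SCALAR EQUATION FOR `k`**.  Let `B = k·B⋆` on the open `I × U` off the principal planes solve the passive
viscous equation `∂ₜB + DB[Sx] − SB = νΔB`, and let the space gradient of `k` be radial, `∇k = λ x`, with `λ(t, ·)`
differentiable.  Then `∂ₜk − ν Dλ[x] − 7νλ = λ·xᵀSx` on `I × U` (component `0` of the equation, divided by `B⋆₀ ≠ 0`;
`B⋆` itself solves the steady equation, `StrainShadowSurvivor`). -/
theorem shadow_coeff_pde (hν : 0 < ν) (hbc : b ≠ c) (htr : a + b + c = 0) (hI : IsOpen I) (hU : IsOpen U)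
    (hoff : U ⊆ {x | x 0 ≠ 0 ∧ x 1 ≠ 0 ∧ x 2 ≠ 0})
    (hk : ContDiffOn ℝ (⊤ : ℕ∞) (Function.uncurry k) (I ×ˢ U))
    (hBk : ∀ t ∈ I, ∀ x ∈ U, B t x = k t x • (Real.exp (quadForm a b c x / (2 * ν)) • topField a b c x))
    (heq : ∀ t ∈ I, ∀ x ∈ U,
      deriv (fun s => B s x) t + fderiv ℝ (B t) x (strain a b c x) - strain a b c (B t x)
        = ν • Laplacian.laplacian (B t) x)
    (hlam : ∀ t ∈ I, ∀ x ∈ U, gradient (k t) x = lam t x • x)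
    (hlamd : ∀ t ∈ I, ∀ x ∈ U, DifferentiableAt ℝ (lam t) x) :
    ∀ t ∈ I, ∀ x ∈ U,
      deriv (fun s => k s x) t - ν * fderiv ℝ (lam t) x x - 7 * ν * lam t x = lam t x * quadForm a b c x := by
  intro t ht x hx
  have hν0 : ν ≠ 0 := hν.ne'
  set Bs : E3 → E3 := fun y => Real.exp (quadForm a b c y / (2 * ν)) • topField a b c y with hBsdef
  set E : E3 → ℝ := fun y => Real.exp (quadForm a b c y / (2 * ν)) with hEdef
  -- smoothness
  have hkd2 : DifferentiableAt ℝ (Function.uncurry k) (t, x) :=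
    (contDiffAt_of_contDiffOn_prod hk hI hU ht hx).differentiableAt (by simp)
  have hktU : ContDiffOn ℝ (⊤ : ℕ∞) (k t) U := contDiffOn_slice hk ht
  have hkt2 : ContDiffAt ℝ 2 (k t) x := (hktU.contDiffAt (hU.mem_nhds hx)).of_le (by norm_cast)
  have hkd : DifferentiableAt ℝ (k t) x := hkt2.differentiableAt (by simp)
  have hBs : ContDiff ℝ (⊤ : ℕ∞) Bs := contDiff_survivor ν a b c
  have hBsd : DifferentiableAt ℝ Bs x := hBs.differentiable (by simp) x
  have hBs2 : ContDiffAt ℝ 2 Bs x := (hBs.of_le (by norm_cast)).contDiffAt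
  have hBs0 : ContDiff ℝ 2 (fun y => Bs y 0) := (EuclideanSpace.proj (0 : Fin 3) : E3 →L[ℝ] ℝ).contDiff.comp (hBs.of_le (by norm_cast))
  -- the equation near x in the form `k • Bs`
  have hev_x : B t =ᶠ[𝓝 x] fun z => k t z • Bs z := by
    filter_upwards [hU.mem_nhds hx] with z hz using hBk t ht z hz
  have hev_t : (fun s => B s x) =ᶠ[𝓝 t] fun s => k s x • Bs x := by
    filter_upwards [hI.mem_nhds ht] with s hs using hBk s hs x hx
  -- (a) time derivative
  have hkt : HasDerivAt (fun s => k s x) (deriv (fun s => k s x) t) t := by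
    have h1 : HasDerivAt (fun s : ℝ => (s, x)) (1, 0) t := (hasDerivAt_id t).prodMk (hasDerivAt_const t x)
    exact (hkd2.hasFDerivAt.comp_hasDerivAt t h1).differentiableAt.hasDerivAt
  have ha : deriv (fun s => B s x) t = deriv (fun s => k s x) t • Bs x := by
    rw [hev_t.deriv_eq]; exact (hkt.smul_const (Bs x)).deriv
  -- (b) space derivative along `Sx`
  have hb : fderiv ℝ (B t) x (strain a b c x)
      = k t x • fderiv ℝ Bs x (strain a b c x) + fderiv ℝ (k t) x (strain a b c x) • Bs x := by
    rw [hev_x.fderiv_eq, fderiv_fun_smul hkd hBsd]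
    simp [ContinuousLinearMap.smulRight_apply]
  -- (c) the strain term
  have hc : strain a b c (B t x) = k t x • strain a b c (Bs x) := by rw [hBk t ht x hx, strain_smul]
  -- (d) the Laplacian, component 0
  have hB2 : ContDiffAt ℝ 2 (B t) x :=
    (hkt2.smul hBs2).congr_of_eventuallyEq hev_x
  have hd : (Laplacian.laplacian (B t) x) 0
      = k t x * Laplacian.laplacian (fun y => Bs y 0) x + Bs x 0 * Laplacian.laplacian (k t) x
        + 2 * ∑ i : Fin 3, fderiv ℝ (k t) x (EuclideanSpace.single i 1) * fderiv ℝ (fun y => Bs y 0) x (EuclideanSpace.single i 1) := by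
    rw [laplacian_apply_coord hB2]
    have hev0 : (fun y => B t y 0) =ᶠ[𝓝 x] fun y => k t y * Bs y 0 := by
      filter_upwards [hev_x] with y hy; rw [hy]; simp
    rw [(InnerProductSpace.laplacian_congr_nhds hev0).eq_of_nhds, laplacian_mul_of_contDiffOn hU hktU hBs0 hx]
  -- (e) the survivor's own equation, component 0
  have he : (fderiv ℝ Bs x (strain a b c x) - strain a b c (Bs x)) 0 = (ν • Laplacian.laplacian Bs x) 0 :=
    survivor_pde_apply_zero ν a b c hν htr x
  rw [PiLp.sub_apply, PiLp.smul_apply, smul_eq_mul, laplacian_apply_coord hBs2] at he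
  -- (f) component 0 of the equation
  have hf := congrArg (fun w : E3 => w 0) (heq t ht x hx)
  simp only [PiLp.add_apply, PiLp.sub_apply, PiLp.smul_apply, smul_eq_mul, ha, hb, hc, hd] at hf
  -- (g) the gradient is radial: partials of `k`, `Dk[Sx] = λ q`, the frame sum, `Δk = 3λ + Dλ[x]`
  have hpart : ∀ v : E3, fderiv ℝ (k t) x v = lam t x * inner ℝ x v := by
    intro v
    rw [← Literature.Analysis.FluidPDE.inner_gradient_left, hlam t ht x hx, real_inner_smul_left]
  have hsum : ∑ i : Fin 3, fderiv ℝ (k t) x (EuclideanSpace.single i 1) * fderiv ℝ (fun y => Bs y 0) x (EuclideanSpace.single i 1)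
      = lam t x * fderiv ℝ (fun y => Bs y 0) x x := by
    rw [clm_apply_eq_sum_coord (fderiv ℝ (fun y => Bs y 0) x) x, Finset.mul_sum]
    refine Finset.sum_congr rfl fun i _ => ?_
    rw [hpart, EuclideanSpace.inner_single_right]
    simp; ring
  have hΔk : Laplacian.laplacian (k t) x
      = 3 * lam t x + fderiv ℝ (lam t) x x := by
    rw [← HorizonTower.divergence_gradient_eq_laplacian_of_contDiffAt hkt2]
    have hev : gradient (k t) =ᶠ[𝓝 x] fun z => lam t z • z := by
      filter_upwards [hU.mem_nhds hx] with z hz using hlam t ht z hz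
    rw [divergence_congr_nhds hev, HorizonTower.divergence_smul_apply (hlamd t ht x hx) differentiableAt_fun_id,
      divergence_id_three]
    ring
  have hBs0x : Bs x 0 = E x * ((b - c) * x 1 * x 2) := survivor_apply_zero x
  have hDBs : ν * fderiv ℝ (fun y => Bs y 0) x x = (quadForm a b c x + 2 * ν) * (E x * ((b - c) * x 1 * x 2)) :=
    fderiv_survivor_zero_self hν0 x
  rw [hsum, hΔk, hBs0x, hpart, real_inner_comm, strain_dot_self] at hf
  -- (h) divide by `B⋆₀(x) ≠ 0`
  have hx' := hoff hx
  have hne : E x * ((b - c) * x 1 * x 2) ≠ 0 :=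
    mul_ne_zero (Real.exp_pos _).ne' (mul_ne_zero (mul_ne_zero (sub_ne_zero.mpr hbc) hx'.2.1) hx'.2.2)
  have key : (E x * ((b - c) * x 1 * x 2))
      * (deriv (fun s => k s x) t - ν * fderiv ℝ (lam t) x x - 7 * ν * lam t x - lam t x * quadForm a b c x) = 0 := by
    linear_combination hf - k t x * he + 2 * lam t x * hDBs
  have := (mul_eq_zero.mp key).resolve_left hne
  linarith

end ShadowCoeff

end Summit.NavierStokesRegularity.NavierStokesRegularity.Theorems.PoloidalLiouville.ErtelTower
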